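import Literature.AlgebraicGeometry.Resolution.ZariskiClosedPoints
import Mathlib.RingTheory.AdicCompletion.LocalRing
import Mathlib.RingTheory.AdicCompletion.AsTensorProduct
import Mathlib.RingTheory.Flat.Basic
import Mathlib.RingTheory.TensorProduct.Maps
import Mathlib.Algebra.Polynomial.Lifts
import HarnessLib

/-!
# Extending a dominating valuation to a component of the formal completion

Topic: `Literature/AlgebraicGeometry/Resolution`. PROVED commutative algebra behind the first
step of Cossart–Piltant's descent of local uniformization from complete local domains
(journal Prop. 4.8 = arXiv:1412.0868v1 Prop. 4.6, the named fact
`CossartPiltant2019LU3OfComplete` of `ArithmeticalThreefolds.lean`):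

  "Since `A` is local quasi-excellent, its formal completion `Â` w.r.t. `m_A` is reduced, so
  `K̂ := Tot(Â) = ∏ᵢ K̂ᵢ`, `K̂ᵢ = QF(Â/P̂ᵢ)` and the `P̂ᵢ`'s are minimal primes. Let `v̂` be an
  extension of `v` to, say `K̂₁`, after possibly renumbering. … Let `ŷ ∈ 𝒴̂` be the center of
  `v̂`."  (v1 p. 53)

For the rest of that proof `v̂` must be CENTRED over the closed point, i.e. non-negative on
`Â/P̂₁` and positive on its maximal ideal, and — to feed (LU) for the complete local domain
`Â/P̂₁` (`CossartPiltant2019LUComplete3`) — it must again be a valuation "as in (LU)": residue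
field algebraic over the residue field `k` of `Â/P̂₁`. Such an extension exists for SOME minimal
prime `P̂₁` (not for all of them: for the valuation of one branch of a node and `P̂₁` the other
formal branch there is none), for valuations of any rank. We prove this here, in the (LU) format
of `CPLocalUniformization`:

* `exists_minimalPrime_valuationSubring_adicCompletion` — `(A, 𝔪, k)` a Noetherian local domain,
  `K = Frac A`, `O ⊇ A` a valuation ring of `K` with `𝔪_O ∩ A = 𝔪` and `κ(O) | k` algebraic.
  Then there is a minimal prime `P` of `Â = AdicCompletion 𝔪 A` with `P ∩ A = (0)` such that
  for every presentation `π : Â ↠ R` of `Â/P`, every field `K' ⊇ R` and every compatible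
  `ι : K → K'` there is a valuation ring `O'` of `K'` containing and dominating `R`, with
  `κ(O') | κ(R)` algebraic, and `O' ∩ K = O`.

It is deduced from a statement about an arbitrary FLAT `A`-algebra `B` in place of `Â`
(flatness of `Â`: Mathlib `AdicCompletion.flat_of_isNoetherian`; `Â/𝔪Â = k`:
`AdicCompletion.residueField_map_bijective`):

* `exists_minimalPrime_valuationSubring_of_isIntegral` — `A` a domain, `O ⊇ A` a valuation
  ring of `K = Frac A` with `κ(O)` integral over `A` (a closed point of `Zar(K/A)`,
  `ZariskiClosedPoints.lean`), `B` flat over `A`, `β : B → κ(O)` compatible with `A → κ(O)`: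
  there is a minimal prime `P` of `B` over `(0)` such that for all `g : B → K'` with kernel `P`
  and compatible `ι : K → K'` some valuation ring `O' ∋ g(B)` of `K'` has `ker β ↦ 𝔪_{O'}`,
  `κ(O')` integral over `A`, and `O' ∩ K = O`;
* `exists_minimalPrime_valuationSubring_of_cp` — the same for `A` local in the (LU) format.

## The argument

Let `S := B ⊗[A] O` and `φ : S → κ(O)`, `b ⊗ o ↦ β(b)·ō`; `φ` is onto, so `𝔐 := ker φ` is a
maximal ideal; let `𝔓 ⊆ 𝔐` be a minimal prime of `S` and `P := 𝔓 ∩ B`.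
* (`FlatTensorFraction`) Since `B` is flat over `A` and `O ⊆ Frac A`: non-zero elements of `A`
  are non-zero-divisors on `S`, hence lie outside the minimal prime `𝔓`; `B → S` is injective;
  every `s ∈ S` has `t • s = b ⊗ 1` for some `t ∈ A ∖ 0`. Consequently `s ∈ 𝔓 ⇔ b ∈ P`, and
  `P` is a minimal prime of `B` (a prime `Q ⊊ P` would give the prime
  `{s : t • s ∈ Q ⊗ 1} ⊊ 𝔓`), lying over `(0)`.
* Given `g : B → K'` with kernel `P` and `ι`, the map `φ' : S → K'`, `b ⊗ o ↦ g(b) ι(o)`, has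
  kernel inside `𝔓 ⊆ 𝔐`, so it extends to the local ring `S_𝔐`; Chevalley's theorem (Mathlib
  `IsLocalRing.exists_factor_valuationRing`) gives a valuation ring `W` of `K'` dominating
  `S_𝔐`, and below it a closed point `O' ⊆ W` of `Zar(K'/S)`
  (`ZariskiRiemannSpace.exists_le_isClosed`); elements of `𝔐` stay non-units in `O'`.
* `ker β ⊗ 1 ⊆ 𝔐` and `1 ⊗ 𝔪_O ⊆ 𝔐`, so `ker β ↦ 𝔪_{O'}` and `O'` dominates `ι(O)`, whence
  `O' ∩ K = O` (valuation rings are maximal for domination, Mathlib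
  `ValuationSubring.isMax_toLocalSubring`).
* `κ(O')` is integral over `S` (closed point); modulo `𝔐` every `b ⊗ 1` is some `1 ⊗ o`, so the
  residues of `S` in `κ(O')` are residues of `O`, and `κ(O')` is integral over `κ(O)`, which is
  integral over `A`: `O'` is a closed point of `Zar(K'/A)`, i.e. satisfies the (LU) hypotheses
  over `A` (`ZariskiRiemannSpace.isClosed_singleton_iff_cp`), hence over `R = B/P` when `B`
  is local with `ker β = 𝔪_B`.

No new definitions, no named facts.

## Sources

* V. Cossart, O. Piltant, *Resolution of singularities of arithmetical threefolds*, J. Algebra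
  529 (2019) 268–535 = arXiv:1412.0868; proof of Prop. 4.8 (v1: Prop. 4.6, p. 53).
  [CossartPiltant2019]
* O. Zariski, P. Samuel, *Commutative Algebra* II, Ch. VI §4 (existence of valuation rings
  dominating a local ring; maximality for domination). [ZariskiSamuel1960]
-/

noncomputable section

open IsLocalRing Polynomial TensorProduct

namespace Literature.AlgebraicGeometry.Resolution

universe u v w

/-! ## Flat base change of a subring of the fraction field: torsion and minimal primes -/

namespace FlatTensorFraction

variable {A : Type u} [CommRing A] {B : Type u} [CommRing B] [Algebra A B]
  {O : Type u} [CommRing O] [Algebra A O]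

/-- On `B ⊗[A] O`, multiplication by `t ∈ A` is `id_B ⊗ (t • ·)`. [folklore] -/
theorem lTensor_lsmul_apply (t : A) (s : B ⊗[A] O) :
    (LinearMap.lsmul A O t).lTensor B s = t • s := by
  induction s using TensorProduct.induction_on with
  | zero => simp
  | tmul b o => simp [LinearMap.lTensor_tmul, TensorProduct.tmul_smul]
  | add x y hx hy => simp [map_add, hx, hy, smul_add]

/-- If `B` is flat over `A` and `t ∈ A` acts injectively on `O`, then `t` acts injectively on
`B ⊗[A] O`. [folklore] -/
theorem smul_injective_of_flat [Module.Flat A B] {t : A}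
    (ht : Function.Injective (fun o : O => t • o)) :
    Function.Injective (fun s : B ⊗[A] O => t • s) := by
  have h := Module.Flat.lTensor_preserves_injective_linearMap (M := B) (LinearMap.lsmul A O t) ht
  intro x y hxy
  apply h
  simp only [lTensor_lsmul_apply]
  exact hxy

/-- If `B` is flat over `A` and `A → O` is injective then `B → B ⊗[A] O`, `b ↦ b ⊗ 1`, is
injective. [folklore] -/
theorem includeLeftRingHom_injective [Module.Flat A B]
    (hO : Function.Injective (algebraMap A O)) :
    Function.Injective (Algebra.TensorProduct.includeLeftRingHom : B →+* B ⊗[A] O) := by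
  have h := Module.Flat.lTensor_preserves_injective_linearMap (M := B) (Algebra.linearMap A O) hO
  have hcomp : ∀ b : B, (Algebra.TensorProduct.includeLeftRingHom : B →+* B ⊗[A] O) b =
      (Algebra.linearMap A O).lTensor B ((TensorProduct.rid A B).symm b) := by
    intro b
    simp [Algebra.TensorProduct.includeLeftRingHom_apply, LinearMap.lTensor_tmul]
  intro x y hxy
  have : (Algebra.linearMap A O).lTensor B ((TensorProduct.rid A B).symm x) =
      (Algebra.linearMap A O).lTensor B ((TensorProduct.rid A B).symm y) := by
    rw [← hcomp, ← hcomp]; exact hxy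
  exact (TensorProduct.rid A B).symm.injective (h this)

/-- If every element of `O` becomes an element of `A` after multiplication by a non-zero
element of `A` (e.g. `A ⊆ O ⊆ Frac A`), then every element of `B ⊗[A] O` becomes an element
`b ⊗ 1` of `B` after multiplication by a non-zero element of `A`. [folklore] -/
theorem exists_smul_eq_includeLeft [IsDomain A]
    (hfrac : ∀ o : O, ∃ a t : A, t ≠ 0 ∧ t • o = algebraMap A O a) (s : B ⊗[A] O) :
    ∃ t : A, t ≠ 0 ∧ ∃ b : B, t • s = b ⊗ₜ[A] (1 : O) := by
  induction s using TensorProduct.induction_on with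
  | zero => exact ⟨1, one_ne_zero, 0, by simp⟩
  | tmul b o =>
    obtain ⟨a, t, ht, hto⟩ := hfrac o
    refine ⟨t, ht, a • b, ?_⟩
    rw [← TensorProduct.tmul_smul, hto, Algebra.algebraMap_eq_smul_one, TensorProduct.tmul_smul,
      TensorProduct.smul_tmul']
  | add x y hx hy =>
    obtain ⟨t₁, ht₁, b₁, h₁⟩ := hx
    obtain ⟨t₂, ht₂, b₂, h₂⟩ := hy
    refine ⟨t₁ * t₂, mul_ne_zero ht₁ ht₂, t₂ • b₁ + t₁ • b₂, ?_⟩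
    rw [smul_add, mul_comm t₁ t₂, mul_smul, h₁, mul_comm t₂ t₁, mul_smul, h₂,
      TensorProduct.add_tmul, ← TensorProduct.smul_tmul', ← TensorProduct.smul_tmul']

section MinimalPrimes

variable [Module.Flat A B]
  (hOt : ∀ t : A, t ≠ 0 → Function.Injective (fun o : O => t • o))

include hOt in
/-- If `B` is flat over `A` and the non-zero elements of `A` act injectively on `O`, no minimal
prime of `B ⊗[A] O` contains (the image of) a non-zero element of `A`: minimal primes consist
of zero-divisors. [folklore] -/
theorem algebraMap_notMem_of_mem_minimalPrimes {𝔓 : Ideal (B ⊗[A] O)}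
    (h𝔓 : 𝔓 ∈ minimalPrimes (B ⊗[A] O)) {t : A} (ht : t ≠ 0) :
    algebraMap A (B ⊗[A] O) t ∉ 𝔓 := by
  intro hmem
  refine notMem_nonZeroDivisors_of_mem_mem_minimalPrimes hmem h𝔓 ?_
  rw [mem_nonZeroDivisors_iff_right]
  intro x hx
  apply smul_injective_of_flat (B := B) (hOt t ht)
  simp only [smul_zero]
  rw [Algebra.smul_def, mul_comm]
  exact hx

variable [IsDomain A] (hfrac : ∀ o : O, ∃ a t : A, t ≠ 0 ∧ t • o = algebraMap A O a)

include hOt hfrac in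
/-- Membership in a minimal prime `𝔓` of `B ⊗[A] O` is decided in `B`: `s ∈ 𝔓` iff
`t • s = b ⊗ 1` for some non-zero `t ∈ A` and some `b` in the contraction of `𝔓` to `B`.
[folklore] -/
theorem mem_minimalPrimes_iff {𝔓 : Ideal (B ⊗[A] O)} (h𝔓 : 𝔓 ∈ minimalPrimes (B ⊗[A] O))
    (s : B ⊗[A] O) :
    s ∈ 𝔓 ↔ ∃ t : A, t ≠ 0 ∧ ∃ b ∈ 𝔓.comap
      (Algebra.TensorProduct.includeLeftRingHom : B →+* B ⊗[A] O), t • s = b ⊗ₜ[A] (1 : O) := by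
  haveI := h𝔓.1.1
  constructor
  · intro hs
    obtain ⟨t, ht, b, hb⟩ := exists_smul_eq_includeLeft hfrac s
    refine ⟨t, ht, b, ?_, hb⟩
    rw [Ideal.mem_comap, Algebra.TensorProduct.includeLeftRingHom_apply, ← hb, Algebra.smul_def]
    exact 𝔓.mul_mem_left _ hs
  · rintro ⟨t, ht, b, hb, hs⟩
    rw [Ideal.mem_comap, Algebra.TensorProduct.includeLeftRingHom_apply, ← hs, Algebra.smul_def]
      at hb
    exact ((Ideal.IsPrime.mem_or_mem ‹𝔓.IsPrime› hb).resolve_left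
      (algebraMap_notMem_of_mem_minimalPrimes hOt h𝔓 ht))

include hOt hfrac in
/-- **Contraction of a minimal prime along a flat base change of `A ⊆ O ⊆ Frac A`.** If `B` is
flat over `A`, `A → O` is injective with the non-zero elements of `A` acting injectively on `O`,
and every element of `O` is a fraction `a/t`, then the contraction to `B` of a minimal prime of
`B ⊗[A] O` is a minimal prime of `B` lying over `(0) ⊆ A`. (After inverting `A ∖ 0` the map
`B → B ⊗[A] O` becomes an isomorphism.) [folklore] -/
theorem comap_mem_minimalPrimes (hO : Function.Injective (algebraMap A O))
    {𝔓 : Ideal (B ⊗[A] O)} (h𝔓 : 𝔓 ∈ minimalPrimes (B ⊗[A] O)) :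
    𝔓.comap (Algebra.TensorProduct.includeLeftRingHom : B →+* B ⊗[A] O) ∈ minimalPrimes B ∧
      (𝔓.comap (Algebra.TensorProduct.includeLeftRingHom : B →+* B ⊗[A] O)).comap
        (algebraMap A B) = ⊥ := by
  haveI := h𝔓.1.1
  set iL := (Algebra.TensorProduct.includeLeftRingHom : B →+* B ⊗[A] O) with hiL
  set P := 𝔓.comap iL with hP
  have hiL_inj : Function.Injective iL := includeLeftRingHom_injective hO
  have hiL_apply : ∀ b : B, iL b = b ⊗ₜ[A] (1 : O) := fun b => rfl
  have hiL_alg : ∀ t : A, iL (algebraMap A B t) = algebraMap A (B ⊗[A] O) t := fun t => rfl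
  have hiL_smul : ∀ (t : A) (b : B), iL (t • b) = t • iL b := fun t b => by
    rw [hiL_apply, hiL_apply, TensorProduct.smul_tmul']
  -- non-zero elements of `A` avoid `P`
  have htP : ∀ t : A, t ≠ 0 → algebraMap A B t ∉ P := by
    intro t ht h
    rw [hP, Ideal.mem_comap, hiL_alg] at h
    exact algebraMap_notMem_of_mem_minimalPrimes hOt h𝔓 ht h
  -- from `t • b ∈ Q`, `t ≠ 0`, conclude `b ∈ Q` for primes `Q ≤ P`
  have hcancel : ∀ {Q : Ideal B}, Q.IsPrime → Q ≤ P → ∀ {t : A}, t ≠ 0 → ∀ {b : B},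
      t • b ∈ Q → b ∈ Q := by
    intro Q hQ hQP t ht b hb
    rw [Algebra.smul_def] at hb
    exact (hQ.mem_or_mem hb).resolve_left fun h => htP t ht (hQP h)
  refine ⟨?_, ?_⟩
  · -- minimality: a prime `Q ≤ P` gives the prime `𝔔 = {s : t • s ∈ Q ⊗ 1} ≤ 𝔓`, so `𝔔 = 𝔓`
    haveI hPprime : P.IsPrime := Ideal.comap_isPrime iL 𝔓
    refine ⟨⟨hPprime, bot_le⟩, ?_⟩
    rintro Q ⟨hQprime, -⟩ hQP
    -- the ideal `𝔔`
    let 𝔔 : Ideal (B ⊗[A] O) :=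
      { carrier := {s | ∃ t : A, t ≠ 0 ∧ ∃ q ∈ Q, t • s = iL q}
        zero_mem' := ⟨1, one_ne_zero, 0, Q.zero_mem, by simp⟩
        add_mem' := by
          rintro x y ⟨t₁, ht₁, q₁, hq₁, h₁⟩ ⟨t₂, ht₂, q₂, hq₂, h₂⟩
          refine ⟨t₁ * t₂, mul_ne_zero ht₁ ht₂, t₂ • q₁ + t₁ • q₂,
            Q.add_mem (by rw [Algebra.smul_def]; exact Q.mul_mem_left _ hq₁)
              (by rw [Algebra.smul_def]; exact Q.mul_mem_left _ hq₂), ?_⟩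
          rw [smul_add, mul_comm t₁ t₂, mul_smul, h₁, mul_comm t₂ t₁, mul_smul, h₂, map_add,
            hiL_smul, hiL_smul]
        smul_mem' := by
          rintro c x ⟨t, ht, q, hq, h⟩
          obtain ⟨t', ht', b', hb'⟩ := exists_smul_eq_includeLeft hfrac c
          have hb'' : t' • c = iL b' := by rw [hb', hiL_apply]
          refine ⟨t' * t, mul_ne_zero ht' ht, b' * q, Q.mul_mem_left _ hq, ?_⟩
          rw [smul_eq_mul, map_mul, ← h, ← hb'', smul_mul_smul_comm] }
    have hmem𝔔 : ∀ s, s ∈ 𝔔 ↔ ∃ t : A, t ≠ 0 ∧ ∃ q ∈ Q, t • s = iL q := fun s => Iff.rfl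
    have h𝔔𝔓 : 𝔔 ≤ 𝔓 := by
      intro s hs
      obtain ⟨t, ht, q, hq, h⟩ := (hmem𝔔 s).mp hs
      have h1 : algebraMap A (B ⊗[A] O) t * s ∈ 𝔓 := by
        rw [← Algebra.smul_def, h, ← Ideal.mem_comap]
        exact hQP hq
      exact ((Ideal.IsPrime.mem_or_mem ‹𝔓.IsPrime› h1).resolve_left
        (algebraMap_notMem_of_mem_minimalPrimes hOt h𝔓 ht))
    have h𝔔prime : 𝔔.IsPrime := by
      refine Ideal.isPrime_iff.mpr ⟨?_, ?_⟩
      · -- `1 ∉ 𝔔`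
        rw [Ne, Ideal.eq_top_iff_one, hmem𝔔]
        rintro ⟨t, ht, q, hq, h⟩
        apply htP t ht (hQP (?_ : algebraMap A B t ∈ Q))
        have : iL (algebraMap A B t) = iL q := by
          rw [hiL_alg, Algebra.algebraMap_eq_smul_one, h]
        rwa [hiL_inj this]
      · intro x y hxy
        obtain ⟨t, ht, q, hq, h⟩ := (hmem𝔔 _).mp hxy
        obtain ⟨t₁, ht₁, b₁, hb₁⟩ := exists_smul_eq_includeLeft hfrac x
        obtain ⟨t₂, ht₂, b₂, hb₂⟩ := exists_smul_eq_includeLeft hfrac y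
        have hb₁' : t₁ • x = iL b₁ := by rw [hb₁, hiL_apply]
        have hb₂' : t₂ • y = iL b₂ := by rw [hb₂, hiL_apply]
        -- `t • (b₁ b₂) = (t₁ t₂) • q` in `B`
        have key : iL (t • (b₁ * b₂)) = iL ((t₁ * t₂) • q) := by
          rw [hiL_smul, hiL_smul, map_mul, ← hb₁', ← hb₂', ← h, smul_mul_smul_comm, smul_smul,
            smul_smul, mul_comm (t₁ * t₂) t]
        have hbQ : b₁ * b₂ ∈ Q := by
          refine hcancel hQprime hQP ht ?_
          rw [hiL_inj key, Algebra.smul_def]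
          exact Q.mul_mem_left _ hq
        rcases hQprime.mem_or_mem hbQ with h₁ | h₂
        · exact Or.inl ((hmem𝔔 x).mpr ⟨t₁, ht₁, b₁, h₁, hb₁'⟩)
        · exact Or.inr ((hmem𝔔 y).mpr ⟨t₂, ht₂, b₂, h₂, hb₂'⟩)
    -- minimality of `𝔓` forces `𝔓 ≤ 𝔔`, whence `P ≤ Q`
    have h𝔓𝔔 : 𝔓 ≤ 𝔔 := h𝔓.2 ⟨h𝔔prime, bot_le⟩ h𝔔𝔓
    intro b hb
    obtain ⟨t, ht, q, hq, h⟩ := (hmem𝔔 _).mp (h𝔓𝔔 (show iL b ∈ 𝔓 from hb))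
    refine hcancel hQprime hQP ht ?_
    rw [← hiL_smul, hiL_inj.eq_iff] at h
    rw [h]
    exact hq
  · -- `P` lies over `(0)`
    refine eq_bot_iff.mpr fun a ha => ?_
    by_contra ha0
    exact htP a ha0 (by simpa [Ideal.mem_comap] using ha)

end MinimalPrimes

end FlatTensorFraction

/-! ## The extension theorem -/

section Extension

variable {A : Type u} [CommRing A] [IsDomain A] {K : Type u} [Field K] [Algebra A K]
  [IsFractionRing A K] {O : ValuationSubring K} [Algebra A O] [IsScalarTower A O K]

/-- **Extension of a closed point of `Zar(K/A)` along a flat `A`-algebra** (the algebra behind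
"let `v̂` be an extension of `v` to `K̂₁ = QF(Â/P̂₁)` … let `ŷ` be the center of `v̂`",
Cossart–Piltant 2019, proof of Prop. 4.8 = arXiv v1 Prop. 4.6). Let `A` be a domain with
fraction field `K`, `O ⊇ A` a valuation ring of `K` whose residue field is integral over `A`
(i.e. `O` is a closed point of `Zar(K/A)`, `ZariskiClosedPoints.lean`), `B` a FLAT `A`-algebra
and `β : B → κ(O)` a ring map compatible with `A → κ(O)`. Then there is a minimal prime `P` of
`B` with `P ∩ A = (0)` such that for every field `K'`, every `g : B → K'` with kernel `P` and
every compatible `ι : K → K'`, some valuation ring `O'` of `K'` contains `g(B)`, has centre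
containing `ker β`, restricts to `O` on `K` (`O' ∩ K = O` via `ι`) and has residue field
integral over `A` (so `O'` is again a closed point, of `Zar(K'/A)`).
Proof: `S := B ⊗[A] O`, `φ : S → κ(O)`, `b ⊗ o ↦ β(b) ō`, is onto, so `𝔐 := ker φ` is maximal;
take a minimal prime `𝔓 ⊆ 𝔐` and `P := 𝔓 ∩ B` (`FlatTensorFraction.comap_mem_minimalPrimes`);
`S → K'` has kernel inside `𝔓`, so `S_𝔐 → K'` is defined and Chevalley's theorem (Mathlib
`IsLocalRing.exists_factor_valuationRing`) gives a valuation ring `W` dominating `S_𝔐`; a closed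
point `O' ⊆ W` of `Zar(K'/S)` below it (`ZariskiRiemannSpace.exists_le_isClosed`) still sends
`𝔐` to non-units, has residue field integral over `S`, and the residues of `S` are residues of
`O`, whence integrality over `A` by transitivity; `O' ∩ K = O` by maximality of valuation rings
for domination. [cite: CossartPiltant2019, proof of Prop. 4.8 (arXiv v1: Prop. 4.6)] -/
theorem exists_minimalPrime_valuationSubring_of_isIntegral
    (hint : ((IsLocalRing.residue O).comp (algebraMap A O)).IsIntegral)
    {B : Type u} [CommRing B] [Algebra A B] [Module.Flat A B]
    (β : B →+* ResidueField O)
    (hβ : ∀ a : A, β (algebraMap A B a) = residue O (algebraMap A O a)) :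
    ∃ P : Ideal B, P ∈ minimalPrimes B ∧ P.comap (algebraMap A B) = ⊥ ∧
      ∀ (K' : Type v) [Field K'] (g : B →+* K') (ι : K →+* K'),
        RingHom.ker g = P → ι.comp (algebraMap A K) = g.comp (algebraMap A B) →
        ∃ (O' : ValuationSubring K') (hB : ∀ b : B, g b ∈ O'),
          (∀ b : B, β b = 0 → O'.valuation (g b) < 1) ∧
          ((IsLocalRing.residue O').comp
              ((g.comp (algebraMap A B)).codRestrict O' fun _ => hB _)).IsIntegral ∧
          O'.comap ι = O := by
  classical
  -- basic facts on `A → O ⊆ K = Frac A`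
  have hcoe : ∀ a : A, ((algebraMap A O a : O) : K) = algebraMap A K a := fun a =>
    (IsScalarTower.algebraMap_apply A O K a).symm
  have hinjO : Function.Injective (algebraMap A O) := fun a b h => by
    apply IsFractionRing.injective A K
    rw [← hcoe, ← hcoe, h]
  have hOt : ∀ t : A, t ≠ 0 → Function.Injective (fun o : O => t • o) := by
    intro t ht x y hxy
    simp only [Algebra.smul_def] at hxy
    exact mul_left_cancel₀ ((map_ne_zero_iff _ hinjO).mpr ht) hxy
  have hfrac : ∀ o : O, ∃ a t : A, t ≠ 0 ∧ t • o = algebraMap A O a := by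
    intro o
    obtain ⟨a, s, hs, h⟩ := IsFractionRing.div_surjective (A := A) (o : K)
    have hs0 : algebraMap A K s ≠ 0 := IsFractionRing.to_map_ne_zero_of_mem_nonZeroDivisors hs
    refine ⟨a, s, nonZeroDivisors.ne_zero hs, Subtype.ext ?_⟩
    rw [Algebra.smul_def, MulMemClass.coe_mul, hcoe, hcoe, ← h]
    field_simp
  -- the ring `S = B ⊗[A] O` and `φ : S → κ(O)`, `b ⊗ o ↦ β b * ō`
  let βₐ : B →ₐ[A] ResidueField O :=
    { β with
      commutes' := fun a => by
        simp only [RingHom.toMonoidHom_eq_coe, OneHom.toFun_eq_coe, MonoidHom.toOneHom_coe,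
          MonoidHom.coe_coe, hβ]
        rfl }
  let ρₐ : O →ₐ[A] ResidueField O := IsScalarTower.toAlgHom A O (ResidueField O)
  let φ : B ⊗[A] O →ₐ[A] ResidueField O :=
    Algebra.TensorProduct.lift βₐ ρₐ fun _ _ => Commute.all _ _
  have hφ : ∀ (b : B) (o : O), φ (b ⊗ₜ[A] o) = β b * residue O o := fun b o =>
    Algebra.TensorProduct.lift_tmul βₐ ρₐ (fun _ _ => Commute.all _ _) b o
  have hφsurj : Function.Surjective φ := fun y => by
    obtain ⟨o, rfl⟩ := IsLocalRing.residue_surjective y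
    exact ⟨1 ⊗ₜ o, by rw [hφ, map_one, one_mul]⟩
  set 𝔐 : Ideal (B ⊗[A] O) := RingHom.ker φ.toRingHom with h𝔐def
  have hmem𝔐 : ∀ s, s ∈ 𝔐 ↔ φ s = 0 := fun s => RingHom.mem_ker
  haveI h𝔐max : 𝔐.IsMaximal := RingHom.ker_isMaximal_of_surjective φ.toRingHom hφsurj
  obtain ⟨𝔓, h𝔓, h𝔓𝔐⟩ :=
    Ideal.exists_minimalPrimes_le (I := (⊥ : Ideal (B ⊗[A] O))) (J := 𝔐) bot_le
  haveI h𝔓prime : 𝔓.IsPrime := h𝔓.1.1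
  set iL := (Algebra.TensorProduct.includeLeftRingHom : B →+* B ⊗[A] O) with hiLdef
  have hiL : ∀ b : B, iL b = b ⊗ₜ[A] (1 : O) := fun b => rfl
  let iR : O →+* B ⊗[A] O :=
    (Algebra.TensorProduct.includeRight : O →ₐ[A] B ⊗[A] O).toRingHom
  have hiR : ∀ o : O, iR o = (1 : B) ⊗ₜ[A] o := fun o => rfl
  obtain ⟨hPmin, hPA⟩ := FlatTensorFraction.comap_mem_minimalPrimes (B := B) hOt hfrac hinjO h𝔓
  refine ⟨𝔓.comap iL, hPmin, hPA, ?_⟩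
  intro K' _ g ι hker hcomp
  -- `φ' : S → K'`, `b ⊗ o ↦ g b * ι o`
  letI : Algebra A K' := (g.comp (algebraMap A B)).toAlgebra
  have hι : ∀ a : A, ι (algebraMap A K a) = g (algebraMap A B a) := fun a =>
    RingHom.congr_fun hcomp a
  let gₐ : B →ₐ[A] K' := { g with commutes' := fun _ => rfl }
  let ιₐ : O →ₐ[A] K' :=
    { ι.comp O.subtype with
      commutes' := fun a => by
        show ι ((algebraMap A O a : O) : K) = g (algebraMap A B a)
        rw [hcoe, hι] }
  let φ' : B ⊗[A] O →ₐ[A] K' := Algebra.TensorProduct.lift gₐ ιₐ fun _ _ => Commute.all _ _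
  have hφ' : ∀ (b : B) (o : O), φ' (b ⊗ₜ[A] o) = g b * ι o := fun b o =>
    Algebra.TensorProduct.lift_tmul gₐ ιₐ (fun _ _ => Commute.all _ _) b o
  have hφ'iL : ∀ b : B, φ' (iL b) = g b := fun b => by
    rw [hiL, hφ', OneMemClass.coe_one, map_one, mul_one]
  have hφ'iR : ∀ o : O, φ' (iR o) = ι o := fun o => by
    rw [hiR, hφ', map_one, one_mul]
  have htK' : ∀ t : A, t ≠ 0 → algebraMap A K' t ≠ 0 := fun t ht => by
    show g (algebraMap A B t) ≠ 0
    rw [← hι]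
    exact (map_ne_zero ι).mpr ((map_ne_zero_iff _ (IsFractionRing.injective A K)).mpr ht)
  -- `ker φ' ⊆ 𝔓`
  have hkerφ' : ∀ s, φ' s = 0 → s ∈ 𝔓 := by
    intro s hs
    obtain ⟨t, ht, b, hb⟩ := FlatTensorFraction.exists_smul_eq_includeLeft hfrac s
    rw [FlatTensorFraction.mem_minimalPrimes_iff hOt hfrac h𝔓]
    refine ⟨t, ht, b, ?_, hb⟩
    show b ∈ Ideal.comap iL 𝔓
    rw [← hker, RingHom.mem_ker, ← hφ'iL, hiL, ← hb, map_smul, hs, smul_zero]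
  -- Chevalley: a valuation ring `W` of `K'` dominating `S_𝔐`
  have hunit : ∀ y : 𝔐.primeCompl, IsUnit (φ'.toRingHom y) := by
    rintro ⟨y, hy⟩
    refine isUnit_iff_ne_zero.mpr fun h0 => hy (h𝔓𝔐 (hkerφ' y h0))
  let f : Localization.AtPrime 𝔐 →+* K' := IsLocalization.lift (M := 𝔐.primeCompl) hunit
  have hf : ∀ s, f (algebraMap _ (Localization.AtPrime 𝔐) s) = φ' s := fun s =>
    IsLocalization.lift_eq hunit s
  obtain ⟨W, hW, hWloc⟩ := IsLocalRing.exists_factor_valuationRing f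
  -- a closed point `O' ⊆ W` of `Zar(K'/S)`
  letI algS : Algebra (B ⊗[A] O) K' := φ'.toRingHom.toAlgebra
  let w₀ : ZariskiRiemannSpace (B ⊗[A] O) K' :=
    ⟨W, fun s => by
      show φ' s ∈ W
      rw [← hf]
      exact hW _⟩
  obtain ⟨v, hvW, hvcl⟩ := w₀.exists_le_isClosed
  set O' := v.asValuationSubring with hO'def
  have hSO' : ∀ s, φ' s ∈ O' := fun s => v.algebraMap_mem s
  -- elements of `𝔐` are non-units of `O'`
  have h𝔐lt : ∀ s ∈ 𝔐, O'.valuation (φ' s) < 1 := by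
    intro s hs
    suffices hWlt : W.valuation (φ' s) < 1 by
      rw [← ValuationSubring.mem_nonunits_iff] at hWlt ⊢
      exact (ValuationSubring.nonunits_le_nonunits.mpr hvW) hWlt
    set y := algebraMap _ (Localization.AtPrime 𝔐) s with hy
    have h1 : y ∈ maximalIdeal (Localization.AtPrime 𝔐) :=
      (IsLocalization.AtPrime.to_map_mem_maximal_iff _ 𝔐 s).mpr hs
    have h2 : ¬ IsUnit (f.codRestrict W.toSubring hW y) := fun hu =>
      (mem_nonunits_iff.mp ((mem_maximalIdeal _).mp h1)) (hWloc.map_nonunit _ hu)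
    have h3 : W.valuation ((f.codRestrict W.toSubring hW y : W.toSubring) : K') < 1 := by
      apply (W.valuation_lt_one_iff _).mp
      rw [mem_maximalIdeal, mem_nonunits_iff]
      exact h2
    rwa [show ((f.codRestrict W.toSubring hW y : W.toSubring) : K') = φ' s from hf s] at h3
  have hres𝔐 : ∀ s ∈ 𝔐, v.residueHom s = 0 := by
    intro s hs
    rw [ZariskiRiemannSpace.residueHom_apply, residue_eq_zero_iff,
      ValuationSubring.valuation_lt_one_iff]
    exact h𝔐lt s hs
  -- conclusions
  refine ⟨O', fun b => hφ'iL b ▸ hSO' (iL b), ?_, ?_, ?_⟩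
  · -- `ker β` is mapped into `𝔪_{O'}`
    intro b hb
    rw [← hφ'iL]
    apply h𝔐lt
    rw [hmem𝔐, hiL, hφ, hb, zero_mul]
  · -- the residue field of `O'` is integral over `A`
    have hintS : v.residueHom.IsIntegral :=
      ZariskiRiemannSpace.isClosed_singleton_iff_isIntegral.mp hvcl
    let rO : O →+* ResidueField O' := v.residueHom.comp iR
    -- every residue of an element of `S` is the residue of an element of `O`
    have him : ∀ s, ∃ o : O, v.residueHom s = rO o := by
      intro s
      induction s using TensorProduct.induction_on with
      | zero => exact ⟨0, by rw [map_zero, map_zero]⟩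
      | tmul b o =>
        obtain ⟨ob, hob⟩ := IsLocalRing.residue_surjective (β b)
        refine ⟨ob * o, ?_⟩
        have h1 : b ⊗ₜ[A] o = iL b * iR o := by
          rw [hiL, hiR, Algebra.TensorProduct.tmul_mul_tmul, mul_one, one_mul]
        have h2 : iL b - iR ob ∈ 𝔐 := by
          rw [hmem𝔐, map_sub, hiL, hiR, hφ, hφ, map_one, map_one, mul_one, one_mul, hob, sub_self]
        have h3 : v.residueHom (iL b) = v.residueHom (iR ob) := by
          rw [← sub_eq_zero, ← map_sub]
          exact hres𝔐 _ h2
        rw [h1, map_mul, h3, ← map_mul, ← map_mul]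
        rfl
      | add x y hx hy =>
        obtain ⟨o₁, h₁⟩ := hx
        obtain ⟨o₂, h₂⟩ := hy
        exact ⟨o₁ + o₂, by rw [map_add, h₁, h₂, map_add]⟩
    -- hence `rO` is integral
    have hrO : rO.IsIntegral := by
      intro y
      obtain ⟨p, hpm, hpy⟩ := hintS y
      have hlifts : p.map v.residueHom ∈ Polynomial.lifts rO := by
        rw [Polynomial.lifts_iff_coeff_lifts]
        intro n
        rw [Polynomial.coeff_map]
        obtain ⟨o, ho⟩ := him (p.coeff n)
        exact ⟨o, ho.symm⟩
      obtain ⟨q, hq, -, hqm⟩ := Polynomial.lifts_and_degree_eq_and_monic hlifts (hpm.map _)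
      refine ⟨q, hqm, ?_⟩
      rw [← Polynomial.eval_map, hq, Polynomial.eval_map]
      exact hpy
    -- `rO` kills `𝔪_O`, so it factors through `κ(O)`
    have hrO_m : ∀ o : O, o ∈ maximalIdeal O → rO o = 0 := by
      intro o ho
      apply hres𝔐
      rw [hmem𝔐, hiR, hφ, map_one, one_mul, residue_eq_zero_iff]
      exact ho
    haveI : IsLocalHom rO := ⟨fun o ho => by
      by_contra hno
      have h0 : rO o = 0 := hrO_m o ((mem_maximalIdeal _).mpr (mem_nonunits_iff.mpr hno))
      rw [h0] at ho
      exact not_isUnit_zero ho⟩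
    let rbar : ResidueField O →+* ResidueField O' := ResidueField.lift rO
    have hrbar : rbar.comp (residue O) = rO := ResidueField.lift_comp_residue rO
    have hrbar_int : rbar.IsIntegral :=
      RingHom.IsIntegral.tower_top (residue O) rbar (hrbar ▸ hrO)
    -- `A → κ(O')` is `A → κ(O) → κ(O')`
    have hcomp' : (IsLocalRing.residue O').comp ((g.comp (algebraMap A B)).codRestrict O'
        fun a => hφ'iL (algebraMap A B a) ▸ hSO' (iL (algebraMap A B a))) =
        rbar.comp ((residue O).comp (algebraMap A O)) := by
      refine RingHom.ext fun a => ?_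
      show residue O' _ = rbar (residue O (algebraMap A O a))
      rw [ResidueField.lift_residue_apply]
      show residue O' _ = residue O' (v.algebraMapHom (iR (algebraMap A O a)))
      congr 1
      apply Subtype.ext
      show g (algebraMap A B a) = φ' (iR (algebraMap A O a))
      rw [hφ'iR, hcoe, hι]
    rw [hcomp']
    exact RingHom.IsIntegral.trans _ _ hint hrbar_int
  · -- `O' ∩ K = O`
    have hOO' : ∀ o : O, ι o ∈ O' := fun o => hφ'iR o ▸ hSO' _
    have hmO : ∀ o : O, o ∈ maximalIdeal O → O'.valuation (ι o) < 1 := by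
      intro o ho
      rw [← hφ'iR]
      apply h𝔐lt
      rw [hmem𝔐, hiR, hφ, map_one, one_mul, residue_eq_zero_iff]
      exact ho
    have hle : O.toSubring ≤ (O'.comap ι).toSubring := fun x hx =>
      ValuationSubring.mem_comap.mpr (hOO' ⟨x, hx⟩)
    let r : (O'.comap ι).toSubring →+* O' :=
      (ι.comp (O'.comap ι).toSubring.subtype).codRestrict O' fun y =>
        ValuationSubring.mem_comap.mp y.2
    have hdom : O.toLocalSubring ≤ (O'.comap ι).toLocalSubring := by
      refine ⟨hle, ⟨fun x hx => ?_⟩⟩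
      by_contra hxu
      -- transport (non-)units between the two copies `↥O` and `↥O.toSubring` of `O`
      let e : O →+* O.toLocalSubring.toSubring :=
        { toFun := fun y => ⟨y, y.2⟩
          map_one' := rfl
          map_mul' := fun _ _ => rfl
          map_zero' := rfl
          map_add' := fun _ _ => rfl }
      have he : e ⟨(x : K), x.2⟩ = x := rfl
      have hxm : (⟨(x : K), x.2⟩ : O) ∈ maximalIdeal O :=
        (mem_maximalIdeal _).mpr (mem_nonunits_iff.mpr fun h => hxu (he ▸ h.map e))
      have hlt := hmO _ hxm
      have hu : IsUnit (r (Subring.inclusion hle x)) := hx.map r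
      have h1 := (O'.valuation_eq_one_iff _).mp hu
      exact (ne_of_lt hlt) h1
    have hmax := O.isMax_toLocalSubring hdom
    exact ValuationSubring.toLocalSubring_injective (le_antisymm hmax hdom)

end Extension

/-- **The extension theorem at a closed point, Cossart–Piltant's (LU) format.** Let `(A, 𝔪, k)`
be a local domain with fraction field `K`, `O ⊇ A` a valuation ring of `K` dominating `A`
(`v(a) < 1` on `𝔪`) with residue field algebraic over `k` — the two hypotheses of
`CPLocalUniformization` — and `B` a FLAT `A`-algebra with a ring map `β : B → κ(O)` compatible
with `A → κ(O)` (for `B = Â`: `Â → Â/𝔪Â = k → κ(O)`). Then there is a minimal prime `P` of `B`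
with `P ∩ A = (0)` such that, for every field `K'`, every `g : B → K'` with kernel `P` and every
compatible `ι : K → K'`, some valuation ring `O'` of `K'` contains `g(B)`, sends `ker β` into its
maximal ideal, satisfies the same two hypotheses over `A`, and restricts to `O` on `K`.
[cite: CossartPiltant2019, proof of Prop. 4.8 (arXiv v1: Prop. 4.6)] -/
theorem exists_minimalPrime_valuationSubring_of_cp {A : Type u} [CommRing A] [IsDomain A]
    [IsLocalRing A] {K : Type u} [Field K] [Algebra A K] [IsFractionRing A K]
    (O : ValuationSubring K) (hAO : ∀ a : A, algebraMap A K a ∈ O)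
    (hdom : ∀ a ∈ maximalIdeal A, O.valuation (algebraMap A K a) < 1)
    (halg : ∀ x : O, ∃ p : Polynomial A, (∃ i, p.coeff i ∉ maximalIdeal A) ∧
      O.valuation (p.eval₂ (algebraMap A K) x) < 1)
    {B : Type u} [CommRing B] [Algebra A B] [Module.Flat A B]
    (β : B →+* ResidueField O)
    (hβ : ∀ a : A, β (algebraMap A B a) = residue O ⟨algebraMap A K a, hAO a⟩) :
    ∃ P : Ideal B, P ∈ minimalPrimes B ∧ P.comap (algebraMap A B) = ⊥ ∧
      ∀ (K' : Type v) [Field K'] (g : B →+* K') (ι : K →+* K'),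
        RingHom.ker g = P → ι.comp (algebraMap A K) = g.comp (algebraMap A B) →
        ∃ O' : ValuationSubring K',
          (∀ b : B, g b ∈ O') ∧
          (∀ b : B, β b = 0 → O'.valuation (g b) < 1) ∧
          (∀ a ∈ maximalIdeal A, O'.valuation (g (algebraMap A B a)) < 1) ∧
          (∀ x : O', ∃ p : Polynomial A, (∃ i, p.coeff i ∉ maximalIdeal A) ∧
            O'.valuation (p.eval₂ (g.comp (algebraMap A B)) x) < 1) ∧
          O'.comap ι = O := by
  letI : Algebra A O := ((algebraMap A K).codRestrict O hAO).toAlgebra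
  haveI : IsScalarTower A O K := IsScalarTower.of_algebraMap_eq fun _ => rfl
  -- `O` is a closed point of `Zar(K/A)`: its residue field is integral over `A`
  let vO : ZariskiRiemannSpace A K := ⟨O, hAO⟩
  have hcl : IsClosed ({vO} : Set (ZariskiRiemannSpace A K)) :=
    ZariskiRiemannSpace.isClosed_singleton_iff_cp.mpr ⟨hdom, halg⟩
  have hint : ((IsLocalRing.residue O).comp (algebraMap A O)).IsIntegral :=
    ZariskiRiemannSpace.isClosed_singleton_iff_isIntegral.mp hcl
  obtain ⟨P, hPmin, hPA, H⟩ :=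
    exists_minimalPrime_valuationSubring_of_isIntegral (O := O) hint β hβ
  refine ⟨P, hPmin, hPA, fun K' _ g ι hker hcomp => ?_⟩
  obtain ⟨O', hB, hβO', hint', hcomap⟩ := H K' g ι hker hcomp
  -- `O'` is a closed point of `Zar(K'/A)`
  letI : Algebra A K' := (g.comp (algebraMap A B)).toAlgebra
  let vA : ZariskiRiemannSpace A K' := ⟨O', fun a => hB (algebraMap A B a)⟩
  have hclA : IsClosed ({vA} : Set (ZariskiRiemannSpace A K')) :=
    ZariskiRiemannSpace.isClosed_singleton_iff_isIntegral.mpr hint'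
  obtain ⟨hdomA, halgA⟩ := ZariskiRiemannSpace.isClosed_singleton_iff_cp.mp hclA
  exact ⟨O', hB, hβO', hdomA, halgA, hcomap⟩

/-! ## The formal completion of a Noetherian local domain -/

/-- **Extending a dominating valuation to a component of the formal completion**
(Cossart–Piltant 2019, proof of Prop. 4.8 = arXiv v1 Prop. 4.6: "`K̂ := Tot(Â) = ∏ K̂ᵢ`,
`K̂ᵢ = QF(Â/P̂ᵢ)` and the `P̂ᵢ`'s are minimal primes. Let `v̂` be an extension of `v` to, say
`K̂₁`, after possibly renumbering … Let `ŷ` be the center of `v̂`"). Let `(A, 𝔪, k)` be a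
Noetherian local domain with fraction field `K` and `𝔪`-adic completion `Â`, and let `O` be a
valuation ring of `K` containing `A` with `𝔪_O ∩ A = 𝔪` and `κ(O) | k` algebraic (the
hypotheses of Cossart–Piltant's (LU), `CPLocalUniformization`). Then there is a minimal prime
`P` of `Â`, with `P ∩ A = (0)`, such that for every presentation `π : Â ↠ R` of `Â/P` (`R`
local, `ker π = P`), every field `K' ⊇ R` and every embedding `ι : K → K'` compatible with
`A → Â → R → K'`, there is a valuation ring `O'` of `K'` containing `R`, DOMINATING `R`
(`𝔪_{O'} ∩ R = 𝔪_R`), with `κ(O') | κ(R)` algebraic — i.e. satisfying the hypotheses of (LU)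
for `R` — and restricting to `O` on `K`: `O' ∩ K = O`. (Any rank; `Â` is flat over `A`,
Mathlib `AdicCompletion.flat_of_isNoetherian`, and `Â/𝔪Â = k`,
`AdicCompletion.residueField_map_bijective`; apply
`exists_minimalPrime_valuationSubring_of_cp`.) This is the first step of the descent of (LU)
from `Â` to `A` (`CossartPiltant2019LU3OfComplete`, `ArithmeticalThreefolds.lean`).
[cite: CossartPiltant2019, proof of Prop. 4.8 (arXiv v1: Prop. 4.6)] -/
theorem exists_minimalPrime_valuationSubring_adicCompletion {A : Type u} [CommRing A]
    [IsDomain A] [IsNoetherianRing A] [IsLocalRing A] {K : Type u} [Field K] [Algebra A K]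
    [IsFractionRing A K] (O : ValuationSubring K) (hAO : ∀ a : A, algebraMap A K a ∈ O)
    (hdom : ∀ a ∈ maximalIdeal A, O.valuation (algebraMap A K a) < 1)
    (halg : ∀ x : O, ∃ p : Polynomial A, (∃ i, p.coeff i ∉ maximalIdeal A) ∧
      O.valuation (p.eval₂ (algebraMap A K) x) < 1) :
    ∃ P : Ideal (AdicCompletion (maximalIdeal A) A),
      P ∈ minimalPrimes (AdicCompletion (maximalIdeal A) A) ∧
      P.comap (algebraMap A (AdicCompletion (maximalIdeal A) A)) = ⊥ ∧
      ∀ (R : Type v) [CommRing R] [IsLocalRing R] (π : AdicCompletion (maximalIdeal A) A →+* R),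
        Function.Surjective π → RingHom.ker π = P →
        ∀ (K' : Type w) [Field K'] [Algebra R K'], Function.Injective (algebraMap R K') →
        ∀ ι : K →+* K', ι.comp (algebraMap A K) =
            (algebraMap R K').comp (π.comp (algebraMap A (AdicCompletion (maximalIdeal A) A))) →
          ∃ O' : ValuationSubring K',
            (∀ r : R, algebraMap R K' r ∈ O') ∧
            (∀ r ∈ maximalIdeal R, O'.valuation (algebraMap R K' r) < 1) ∧
            (∀ x : O', ∃ p : Polynomial R, (∃ i, p.coeff i ∉ maximalIdeal R) ∧
              O'.valuation (p.eval₂ (algebraMap R K') x) < 1) ∧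
            O'.comap ι = O := by
  -- `β : Â → Â/𝔪Â = k → κ(O)`
  let jAO : A →+* O := (algebraMap A K).codRestrict O hAO
  haveI : IsLocalHom jAO := ⟨fun a ha => by
    by_contra hna
    have hm : a ∈ maximalIdeal A := (mem_maximalIdeal _).mpr (mem_nonunits_iff.mpr hna)
    exact (ne_of_lt (hdom a hm)) ((O.valuation_eq_one_iff _).mp ha)⟩
  let e : ResidueField A ≃+* ResidueField (AdicCompletion (maximalIdeal A) A) :=
    RingEquiv.ofBijective _ (AdicCompletion.residueField_map_bijective A)
  let β : AdicCompletion (maximalIdeal A) A →+* ResidueField O :=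
    (ResidueField.map jAO).comp (e.symm.toRingHom.comp (residue _))
  have hβ : ∀ a : A, β (algebraMap A _ a) = residue O ⟨algebraMap A K a, hAO a⟩ := by
    intro a
    show ResidueField.map jAO (e.symm (residue _ (algebraMap A _ a))) = _
    have : residue (AdicCompletion (maximalIdeal A) A) (algebraMap A _ a) = e (residue A a) := rfl
    rw [this, RingEquiv.symm_apply_apply, ResidueField.map_residue]
    rfl
  have hβker : ∀ b : AdicCompletion (maximalIdeal A) A, b ∈ maximalIdeal _ → β b = 0 := by
    intro b hb
    show ResidueField.map jAO (e.symm (residue _ b)) = 0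
    rw [(residue_eq_zero_iff _).mpr hb, map_zero, map_zero]
  obtain ⟨P, hPmin, hPA, H⟩ := exists_minimalPrime_valuationSubring_of_cp O hAO hdom halg β hβ
  refine ⟨P, hPmin, hPA, ?_⟩
  intro R _ _ π hπ hker K' _ _ hinj ι hι
  set g : AdicCompletion (maximalIdeal A) A →+* K' := (algebraMap R K').comp π with hg
  have hkerg : RingHom.ker g = P := by
    ext b
    rw [RingHom.mem_ker, ← hker, RingHom.mem_ker]
    exact map_eq_zero_iff _ hinj
  obtain ⟨O', hB, hβO', -, halgA, hcomap⟩ := H K' g ι hkerg (by rw [hι]; rfl)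
  refine ⟨O', ?_, ?_, ?_, hcomap⟩
  · intro r
    obtain ⟨b, rfl⟩ := hπ r
    exact hB b
  · intro r hr
    obtain ⟨b, rfl⟩ := hπ r
    have hb : b ∈ maximalIdeal _ :=
      (mem_maximalIdeal _).mpr (mem_nonunits_iff.mpr fun hu =>
        (mem_nonunits_iff.mp ((mem_maximalIdeal _).mp hr)) (hu.map π))
    exact hβO' b (hβker b hb)
  · intro x
    obtain ⟨p, ⟨i, hi⟩, hlt⟩ := halgA x
    refine ⟨p.map (π.comp (algebraMap A _)), ⟨i, ?_⟩, ?_⟩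
    · rw [Polynomial.coeff_map]
      exact IsLocalRing.notMem_maximalIdeal.mpr ((IsLocalRing.notMem_maximalIdeal.mp hi).map _)
    · rw [Polynomial.eval₂_map]
      exact hlt

end Literature.AlgebraicGeometry.Resolution

end
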